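import Summits.AtomisticToContinuum.Crystallization.Theorems.ExcessDecayLiouvilleAuxGradient
import Summits.AtomisticToContinuum.Crystallization.Theorems.ExcessDecayLiouvilleCutoff
import Summits.AtomisticToContinuum.Crystallization.Theorems.ExcessDecayLiouvilleChainDefs

/-!
# Route `ExcessDecayLiouville`: the uniform global gradient bound along the chain (nonlinear half, XXXVIII)

Harmonic-replacement architecture for item `ExcessDecay` (stmt-AtomisticToContinuum-9334), nonlinear half.
`NN_total_le` combines `global_gradient` (radial site cut-off of width `r/4`) with `aux_gradient` (auxiliary cut-off
`= 1` on the sites of `B_{7r/8}(c)`) into ONE bound `NN[χ·ũ, c₀, X] ≤ ntotOf κ r δ ε Du`, uniform in the relaxed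
approximant `aff` as long as its sublattice jump and slope are below the thresholds `1/100`, `1/(200r)` and the
displacement `ũ = (π − id) − aff` is bounded by `Du` on the sites of `B_r(c)`.  This is the global near-neighbour
energy fed to every scale of the chain.
All `[folklore]`; helper lemmas, nothing here closes an item.
-/

noncomputable section

namespace Summit.AtomisticToContinuum.Crystallization.Theorems.ExcessDecayLiouville

open scoped BigOperators Topology InnerProductSpace RealInnerProductSpace Classical
open Literature.MathematicalPhysics.StatisticalMechanics
open Summit.AtomisticToContinuum.Crystallization.Theorems.PhononStabilityNegative

-- Local notation: the force-constant map `K(e)w = h(|e|²)w + 2⟪e,w⟫h′(|e|²)e`.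
local notation3 "𝕂[" e "] " w:max =>
  (-((‖e‖ ^ 2)⁻¹) ^ 7 + ((‖e‖ ^ 2)⁻¹) ^ 4) • w + (2 * ⟪e, w⟫ * (7 * ((‖e‖ ^ 2)⁻¹) ^ 8 - 4 * ((‖e‖ ^ 2)⁻¹) ^ 5)) • e
-- Local notation: the pair force `F(x) = h(|x|²) x`.
local notation3 "𝐅[" x "]" => ((-((‖x‖ ^ 2)⁻¹) ^ 7 + ((‖x‖ ^ 2)⁻¹) ^ 4) • x)

section

variable {X : Set (EuclideanSpace ℝ (Fin 3))} {c : EuclideanSpace ℝ (Fin 3)} {r ε δ κ : ℝ}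
  {t : Fin 2 → EuclideanSpace ℝ (Fin 3)} {A : EuclideanSpace ℝ (Fin 3) →L[ℝ] EuclideanSpace ℝ (Fin 3)}
  {π : EuclideanSpace ℝ (Fin 3) → EuclideanSpace ℝ (Fin 3)}
  {aff : (EuclideanSpace ℝ (Fin 3)) → (EuclideanSpace ℝ (Fin 3))} {a : Fin 2 → EuclideanSpace ℝ (Fin 3)}
  {B : (EuclideanSpace ℝ (Fin 3)) →L[ℝ] (EuclideanSpace ℝ (Fin 3))} {x₀ : EuclideanSpace ℝ (Fin 3)}

variable (hA : Adm₀ A) (hI : Inner₀ t A)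

set_option quotPrecheck false in
-- Local notation: the operator row `(L v)(p)`.
local notation "𝕃" v:max " @ " p:max =>
  tsum (fun q : Sites₀ t A => (if ((p : Sites₀ t A) : EuclideanSpace ℝ (Fin 3)) ≠ q then
    𝕂[((p : Sites₀ t A) : EuclideanSpace ℝ (Fin 3)) - q] (v ((p : Sites₀ t A) : EuclideanSpace ℝ (Fin 3)) - v q) else 0))
set_option quotPrecheck false in
-- Local notation: the finite near-neighbour form on the ball of radius `X` about the centre `cc`.
local notation "NN[" v ", " cc ", " X "]" =>
  (∑ p ∈ (finite_sites_dist_le (t := t) (A := A) hA hI cc X).toFinset,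
    ∑ q ∈ (finite_sites_dist_le (t := t) (A := A) hA hI cc X).toFinset,
      (if p ≠ q ∧ dist p q ≤ 11 / 10 then ‖v p - v q‖ ^ 2 else (0 : ℝ)))
set_option quotPrecheck false in
-- Local notation: the radial site cut-off `= 1` on the sites of `B_{r₁}(c)`, `0` beyond `r₁ + w`, slope `1/w`.
local notation "𝛘[" r₁ ", " w "]" =>
  (fun x : EuclideanSpace ℝ (Fin 3) => (if x ∈ Sites₀ t A then max (min 1 ((r₁ + w - dist x c) / w)) 0 else 0))

include hA hI in
/-- **The uniform global gradient bound** (see the module docstring). [folklore] -/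
theorem NN_total_le (hκ0 : 0 < κ)
    (hκ : ∀ v : (EuclideanSpace ℝ (Fin 3)) → (EuclideanSpace ℝ (Fin 3)), (Function.support v).Finite →
      Function.support v ⊆ Sites₀ t A → κ * nnForm t A v ≤ ∑' p : Sites₀ t A, ⟪𝕃 v @ p, v p⟫)
    (hX : X.Finite) (hsep : Sep₀ X δ) (hequil : Equil₀ X) (hδ : 0 < δ) (hδ1 : δ ≤ 1)
    (hε0 : 0 ≤ ε) (hε : 2 * ε < δ) (hr : 64 ≤ r)
    (hXb : ∀ p ∈ X, dist p c ≤ r → ∃ m : Fin 2, ∃ z ∈ Λ₀, dist p (t m + A z) ≤ ε)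
    (hπ : ∀ s' ∈ Sites₀ t A, dist s' c ≤ r → π s' ∈ X ∧ dist (π s') s' ≤ ε)
    (hinj : ∀ s₁ ∈ Sites₀ t A, ∀ s₂ ∈ Sites₀ t A, dist s₁ c ≤ r → dist s₂ c ≤ r → π s₁ = π s₂ → s₁ = s₂)
    (SR : Finset (EuclideanSpace ℝ (Fin 3))) (hSR : ∀ x, x ∈ SR ↔ x ∈ Sites₀ t A ∧ dist x c ≤ r)
    (haff : ∀ (m : Fin 2) (z : EuclideanSpace ℝ (Fin 3)), z ∈ Λ₀ → aff (t m + A z) = a m + B (t m + A z - x₀))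
    (hrelax : ∀ s : Sites₀ t A, (∑' q : Sites₀ t A, (if (s : EuclideanSpace ℝ (Fin 3)) ≠ q then
        𝐅[((s : EuclideanSpace ℝ (Fin 3)) - q) + (aff s - aff q)] else 0)) = 0)
    (ha : ‖a 0 - a 1‖ ≤ 1 / 100) (hB : ‖B‖ ≤ 1 / 100) (hBr : 2 * r * ‖B‖ ≤ 1 / 100)
    {Du : ℝ} (hDu0 : 0 ≤ Du) (hDu1 : Du ≤ 1 / 20) (hDu : ∀ x ∈ SR, ‖(π x - x) - aff x‖ ≤ Du)
    (hΛκ : 4000000 * (210000 * ((25 / 23) * (2 * Du + 1 / 100) + 1 / 100)) ≤ κ / 12)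
    (c₀ : EuclideanSpace ℝ (Fin 3)) (Xr : ℝ) :
    NN[(fun x => 𝛘[r / 2, r / 4] x • ((π x - x) - aff x)), c₀, Xr] ≤ ntotOf κ r δ ε Du := by
  have hr0 : 0 < r := by linarith
  have hSRS : ∀ x ∈ SR, x ∈ Sites₀ t A := fun x hx => ((hSR x).1 hx).1
  -- the Lipschitz modulus at the actual data is below the one at the thresholds
  have hΛmono : 210000 * ((25 / 23) * (2 * Du + ‖a 0 - a 1‖) + ‖B‖) ≤ 210000 * ((25 / 23) * (2 * Du + 1 / 100) + 1 / 100) := by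
    nlinarith [norm_nonneg (a 0 - a 1), norm_nonneg B]
  have hΛκ' : 4000000 * (210000 * ((25 / 23) * (2 * Du + ‖a 0 - a 1‖) + ‖B‖)) ≤ κ / 12 := by nlinarith [hΛmono]
  -- (1) the auxiliary cut-off and `aux_gradient`
  have hw8 : 0 < r / 8 := by positivity
  have hχ'0 : ∀ q ∈ Sites₀ t A, q ∉ SR → 𝛘[7 * r / 8, r / 8] q = 0 := by
    intro q hq hqSR
    have hqc : r < dist q c := lt_of_not_ge fun h => hqSR ((hSR q).2 ⟨hq, h⟩)
    exact siteCutoff_eq_zero_of_le hw8 (by linarith)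
  have hχ'S : ∀ x, x ∉ Sites₀ t A → 𝛘[7 * r / 8, r / 8] x = 0 := fun x hx => siteCutoff_eq_zero_of_not_mem hx
  have hχ'abs : ∀ x, |𝛘[7 * r / 8, r / 8] x| ≤ 1 := fun x => by
    rw [abs_of_nonneg (siteCutoff_nonneg c _ _ x)]; exact siteCutoff_le_one c _ _ x
  have hχ'1abs : ∀ x, |1 - 𝛘[7 * r / 8, r / 8] x| ≤ 1 := fun x => by
    have h0 := siteCutoff_nonneg (t := t) (A := A) c (7 * r / 8) (r / 8) x
    have h1 := siteCutoff_le_one (t := t) (A := A) c (7 * r / 8) (r / 8) x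
    rw [abs_le]; constructor <;> linarith
  have hχ'one : ∀ q ∈ SR, dist q c ≤ 7 * r / 8 → 𝛘[7 * r / 8, r / 8] q = 1 :=
    fun q hq hqc => siteCutoff_eq_one hw8 (hSRS q hq) hqc
  have hf'fin : (Function.support (fun x => 𝛘[7 * r / 8, r / 8] x • ((π x - x) - aff x))).Finite := by
    refine (siteCutoff_support_finite hA hI c (7 * r / 8) hw8).subset fun x hx => ?_
    simp only [Function.mem_support, ne_eq] at hx ⊢
    intro h0; apply hx; simp only [h0, zero_smul]
  have haux := aux_gradient hA hI hκ0 hκ hX hsep hequil hδ hδ1 hε0 hε hr hXb hπ hinj SR hSR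
    (𝛘[7 * r / 8, r / 8]) hχ'0 hχ'S hχ'abs hχ'1abs hχ'one haff hrelax ha hBr
    (fun x => (π x - x) - aff x) (fun x => 𝛘[7 * r / 8, r / 8] x • ((π x - x) - aff x)) rfl rfl hf'fin hDu0 hDu1 hDu hΛκ'
  -- (2) replace the data by the thresholds
  have e1 : 27 * r / 32 - 13 * r / 16 = r / 32 := by ring
  have e2 : r - 27 * r / 32 = 5 * r / 32 := by ring
  rw [e1, e2] at haux
  have hG : NN[(fun x => (π x - x) - aff x), c, 13 * r / 16] ≤
      2 ^ (5 + 1) *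
        (((2 / κ * (19 * 16 * (1024 / ((23 / 25 : ℝ) ^ 3 * (23 / 25 : ℝ) ^ 3))) +
            16 * (11 / 10 : ℝ) ^ 8 * (1024 / ((23 / 25 : ℝ) ^ 3 * (23 / 25 : ℝ) ^ 3))) *
            (32 * (2 * (27 * r / 32)) ^ 3 * Du ^ 2) * (r / 32) ^ 3 +
          2 / κ * (38 * 4 ^ 5 * (1024 / (23 / 25 : ℝ) ^ 3) * (32 * (2 * (27 * r / 32)) ^ 3 * Du ^ 2) +
            (210000 * ((25 / 23) * (2 * Du + 1 / 100) + 1 / 100)) * 20 ^ 5 * ((7 / 2) * (1024 / (23 / 25 : ℝ) ^ 3) *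
              (32 * (27 * r / 32) ^ 3 * Du ^ 2) + ((1024 / (23 / 25 : ℝ) ^ 3) * (32 * r ^ 3 * Du ^ 2)) / 2)) +
          120 ^ 5 * (160 * (32 * (27 * r / 32) ^ 3 * Du ^ 2))) / (r / 32) ^ 5) +
      2 * (2 / κ * ((31488 * (1024 / ((23 / 25 : ℝ) ^ 3 * (5 * r / 32) ^ 4)) + 2048 / (δ ^ 3 * (5 * r / 32 - 2 * ε) ^ 4) +
          (38 * Du * (1024 / ((23 / 25 : ℝ) ^ 3 * (r / 32) ^ 5)) + 38 * Du * (1024 / ((23 / 25 : ℝ) ^ 3 * (5 * r / 32) ^ 5)))) *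
            Du * (32 * (27 * r / 32) ^ 3) +
          (210000 * ((25 / 23) * (2 * Du + 1 / 100) + 1 / 100)) * (8192 * (27 * r / 32) ^ 3 * 0) / 2 +
          19 * 8192 * (27 * r / 32) ^ 3 * ((13 * r / 16)⁻¹ ^ 8 * (32 * r ^ 3 * Du ^ 2)))) := by
    refine haux.trans ?_
    gcongr
  -- (3) the radial cut-off of width r/4 and `global_gradient`
  have hw4 : 0 < r / 4 := by positivity
  have hχabs : ∀ x, |𝛘[r / 2, r / 4] x| ≤ 1 := fun x => by
    rw [abs_of_nonneg (siteCutoff_nonneg c _ _ x)]; exact siteCutoff_le_one c _ _ x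
  have hlip : ∀ p q : Sites₀ t A, |𝛘[r / 2, r / 4] p - 𝛘[r / 2, r / 4] q| ≤ ‖(p : EuclideanSpace ℝ (Fin 3)) - q‖ / (r / 4) :=
    fun p q => abs_siteCutoff_sub_le hw4 p q
  have hχfar : ∀ x ∈ Sites₀ t A, 3 * r / 4 < dist x c → 𝛘[r / 2, r / 4] x = 0 :=
    fun x _ hxd => siteCutoff_eq_zero_of_le hw4 (by linarith)
  have hglob := global_gradient hA hI hr SR hSR (𝛘[r / 2, r / 4]) hχabs hw4 hlip hχfar (fun x => (π x - x) - aff x) hDu hG c₀ Xr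
  refine hglob.trans (le_of_eq ?_)
  unfold ntotOf
  rw [e1, e2]

end

end Summit.AtomisticToContinuum.Crystallization.Theorems.ExcessDecayLiouville

end
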